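import Literature.Algebra.Lie.SemisimpleDimensionSix
import HarnessLib

/-!
# A semisimple Lie algebra of dimension `8` over a field of characteristic `0` is simple

Topic `Literature/Algebra/Lie`.  Theorems only (no definition, no named fact), Mathlib vocabulary (`LieAlgebra.IsSemisimple`,
`LieAlgebra.IsSimple`, the Boolean algebra of ideals).  Sequel of `SemisimpleDimensionSix` (gen 39 of the cell `pub-hodgecm2`,
seat `b27`, count-neutral Mumford–Tate-rank lane), by the same counting: the atoms of the lattice of ideals are simple, of
dimension `≥ 3` and `∉ {4, 5}` (`three_le_finrank_of_isAtom`, `finrank_atom_ne_four_five`, from the root-space count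
`dim ∉ {1, 2, 4, 5, 7}`); a proper atom `A` of an `8`-dimensional semisimple `L` would have a complement `Aᶜ ≠ 0` containing
an atom `B`, and `dim A + dim Aᶜ = 8` with `dim A, dim B ∈ {3, 6, 7, 8}` leaves only `dim A = dim B = 3`, and then the ideal
`(A ⊔ B)ᶜ` has dimension `2` — too small for an atom, yet non-zero.  Used in `CorCM/MumfordTateRankTypeTwoFourfoldLefschetz`:
at Mumford–Tate rank `9` the Hodge Lie algebra (`𝔷 = 0`) is an `8`-dimensional semisimple, hence SIMPLE, Lie algebra
(a form of `𝔰𝔩₃`), which cannot sit in codimension `2` inside the `10`-dimensional Lefschetz Lie algebra of a type-II fourfold.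

* **`isSimple_of_finrank_eq_eight`** — `L` semisimple over a field of characteristic `0`, `dim L = 8` ⟹ `L` simple.

## References
* [Humphreys1972] J. E. Humphreys, *Introduction to Lie Algebras and Representation Theory*, GTM 9 (1972), §5.2 (a semisimple
  Lie algebra is the direct sum of its simple ideals), §8.4 (`dim L = rank + #Φ`).
-/

namespace Literature.Algebra.Lie

namespace SemisimpleSmallDimension

open LieAlgebra Module

variable {K L : Type*} [Field K] [CharZero K] [LieRing L] [LieAlgebra K L] [FiniteDimensional K L]

omit [CharZero K] in
/-- Dimensions add up along a complementary pair of ideals. [folklore] -/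
private theorem finrank_add_finrank_of_isCompl' {A B : LieIdeal K L} (hc : IsCompl A B) :
    finrank K A + finrank K B = finrank K L := by
  have hc' : IsCompl A.toSubmodule B.toSubmodule := LieSubmodule.isCompl_toSubmodule.2 hc
  have h1 := Submodule.finrank_sup_add_finrank_inf_eq A.toSubmodule B.toSubmodule
  rw [hc'.sup_eq_top, hc'.inf_eq_bot, finrank_top, finrank_bot, add_zero] at h1
  exact h1.symm

/-- **A semisimple Lie algebra of dimension `8` over a field of characteristic `0` is simple** (over an algebraically closed
field it is `𝔰𝔩₃`).  If some atom `A` of the lattice of ideals is proper: `dim A ≥ 3`, `dim A ∉ {4, 5}`, and `Aᶜ ≠ 0`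
contains an atom `B` with the same constraints; `dim A + dim Aᶜ = 8` forces `dim A = 3`, `dim Aᶜ = 5`, `dim B = 3`; then
`A ⊓ B = 0`, `dim (A ⊔ B) = 6`, and the complementary ideal `(A ⊔ B)ᶜ` is non-zero of dimension `2`, hence contains an atom of
dimension `≥ 3` — absurd.  Otherwise every atom is `⊤` and `L` is simple. [cite: Humphreys1972, §5.2] [cite: Humphreys1972, §8.4] -/
theorem isSimple_of_finrank_eq_eight [LieAlgebra.IsSemisimple K L] (h8 : finrank K L = 8) : LieAlgebra.IsSimple K L := by
  by_cases hex : ∃ A : LieIdeal K L, IsAtom A ∧ A ≠ ⊤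
  · exfalso
    obtain ⟨A, hA, hne⟩ := hex
    have h3A := three_le_finrank_of_isAtom (K := K) hA
    have h45A := finrank_atom_ne_four_five (K := K) hA
    have hc : IsCompl A Aᶜ := isCompl_compl
    have hAc : Aᶜ ≠ ⊥ := by
      intro hbot
      apply hne
      have := hc.sup_eq_top
      rwa [hbot, sup_bot_eq] at this
    obtain ⟨B, hB, hBA⟩ := (eq_bot_or_exists_atom_le Aᶜ).resolve_left hAc
    have h3B := three_le_finrank_of_isAtom (K := K) hB
    have h45B := finrank_atom_ne_four_five (K := K) hB
    have hBle : finrank K B ≤ finrank K (Aᶜ : LieIdeal K L) :=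
      Submodule.finrank_mono (show B.toSubmodule ≤ (Aᶜ : LieIdeal K L).toSubmodule from hBA)
    have hsum := finrank_add_finrank_of_isCompl' (K := K) hc
    have e1 : finrank K A.toSubmodule = finrank K A := rfl
    have e2 : finrank K (Aᶜ : LieIdeal K L).toSubmodule = finrank K (Aᶜ : LieIdeal K L) := rfl
    have e3 : finrank K B.toSubmodule = finrank K B := rfl
    -- `A ≠ ⊤` gives `dim A < 8`
    have hAlt : finrank K A < 8 := by
      by_contra hge
      apply hne
      have hsub : A.toSubmodule = (⊤ : LieIdeal K L).toSubmodule := by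
        rw [LieSubmodule.top_toSubmodule]
        exact Submodule.eq_top_of_finrank_eq (by rw [e1, h8]; omega)
      exact (LieSubmodule.toSubmodule_inj A ⊤).1 hsub
    -- hence `dim A = 3`, `dim Aᶜ = 5`, `dim B = 3`
    have hA3 : finrank K A = 3 := by omega
    have hAc5 : finrank K (Aᶜ : LieIdeal K L) = 5 := by omega
    have hB3 : finrank K B = 3 := by omega
    -- `A ⊓ B = 0` and `dim (A ⊔ B) = 6`
    have hAB : A.toSubmodule ⊓ B.toSubmodule = ⊥ := by
      have h1 : A ⊓ B = ⊥ := by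
        rw [eq_bot_iff]
        calc A ⊓ B ≤ A ⊓ Aᶜ := inf_le_inf_left A hBA
          _ = ⊥ := hc.inf_eq_bot
      rw [← LieSubmodule.inf_toSubmodule, h1, LieSubmodule.bot_toSubmodule]
    have hsup6 : finrank K (A ⊔ B : LieIdeal K L).toSubmodule = 6 := by
      have h1 := Submodule.finrank_sup_add_finrank_inf_eq A.toSubmodule B.toSubmodule
      rw [hAB, finrank_bot, add_zero, e1, e3, hA3, hB3] at h1
      rw [LieSubmodule.sup_toSubmodule]
      omega
    -- the complement `C = (A ⊔ B)ᶜ` is a non-zero ideal of dimension `2`: it contains no atom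
    have hcC : IsCompl (A ⊔ B) (A ⊔ B)ᶜ := isCompl_compl
    have hsumC := finrank_add_finrank_of_isCompl' (K := K) hcC
    have e4 : finrank K (A ⊔ B : LieIdeal K L).toSubmodule = finrank K (A ⊔ B : LieIdeal K L) := rfl
    have hC2 : finrank K ((A ⊔ B)ᶜ : LieIdeal K L) = 2 := by omega
    have hCne : ((A ⊔ B)ᶜ : LieIdeal K L) ≠ ⊥ := by
      intro hbot
      have h0 : finrank K ((A ⊔ B)ᶜ : LieIdeal K L).toSubmodule = 0 := by
        rw [hbot, LieSubmodule.bot_toSubmodule, finrank_bot]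
      have e6 : finrank K ((A ⊔ B)ᶜ : LieIdeal K L).toSubmodule = finrank K ((A ⊔ B)ᶜ : LieIdeal K L) := rfl
      omega
    obtain ⟨C, hCatom, hCle⟩ := (eq_bot_or_exists_atom_le ((A ⊔ B)ᶜ : LieIdeal K L)).resolve_left hCne
    have h3C := three_le_finrank_of_isAtom (K := K) hCatom
    have hCle' : finrank K C ≤ finrank K ((A ⊔ B)ᶜ : LieIdeal K L) :=
      Submodule.finrank_mono (show C.toSubmodule ≤ ((A ⊔ B)ᶜ : LieIdeal K L).toSubmodule from hCle)
    have e5 : finrank K C.toSubmodule = finrank K C := rfl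
    omega
  · push Not at hex
    exact isSimple_of_forall_isAtom_eq_top (by omega) hex

end SemisimpleSmallDimension

end Literature.Algebra.Lie
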